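import Literature.AlgebraicGeometry.HodgeTheory.RationalHodgeClasses
import Literature.AlgebraicTopology.SingularHomology.CupProduct
import HarnessLib

/-!
# Integral classes and the Hodge filtration `Fʳ Hᵏ` on `Hᵏ(X(ℂ); ℂ)`

Family `hodge`, layer `Literature/AlgebraicGeometry/HodgeTheory`. Companion to
`RationalHodgeClasses`: two more predicates on a class `c ∈ Hᵏ(X(ℂ); ℂ) =
Literature.singularCohomology ℂ ℂ (ComplexPoints X) k`, phrased with the same real carriers (singular
cochains; Hodge models `HodgeTheory.HodgeModel` = analytification + natural de Rham comparison +
Hodge decomposition), needed to state results about intermediate Jacobians / sub-Hodge structures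
of odd-degree cohomology (consumers: the barrier catalogue `Literature/Barriers/HodgeConjecture`,
Grothendieck's amended generalised Hodge conjecture).

* `IsIntegralClass c` — `c` is represented by a `ℤ`-valued singular cocycle, i.e. lies in the image
  of `Hᵏ(X(ℂ); ℤ) → Hᵏ(X(ℂ); ℂ)` (Voisin I, §7.1.1: "the integral structure"; Hatcher §3.1); the
  `ℤ`-analogue of `HodgeTheory.IsRationalClass`.
* `HodgeModel.hodgeFiltration A k r = Fʳ Hᵏ(X^an; ℂ) := ⨆_{p ≥ r, p + q = k} H^{p,q}` (Voisin I,
  §7.1.1, the Hodge filtration `Fʳ Hᵏ = ⨁_{p ≥ r} H^{p,k-p}` deduced from the Hodge decomposition,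
  Prop. 7.5 / Def. 7.3).
* `IsInHodgeFiltration n X k r c` — for some Hodge model the pull-back of `c` lies in `Fʳ`
  (Deligne, Clay §1: Hodge classes `= H²ᵖ(X, ℚ) ∩ Fᵖ`). Same `∃`-over-models convention and junk
  analysis as `IsOfHodgeType` (module docstring of `RationalHodgeClasses`: all Hodge models of a
  smooth projective `X` induce the same subspaces).

## References

* C. Voisin, *Hodge Theory and Complex Algebraic Geometry I* (2002), §7.1.1.
* P. Deligne, *The Hodge conjecture* (Clay, 2000), §1.
* A. Hatcher, *Algebraic Topology* (2002), §3.1.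
-/

noncomputable section

open CategoryTheory

universe u

namespace Literature.AlgebraicGeometry.HodgeTheory

section HodgeTheory

/-! ### Integral classes in complex singular cohomology -/

/-- A class `c ∈ Hᵏ(Y; ℂ)` is **integral** if it is represented by a singular cocycle all of whose
values lie in `ℤ ⊆ ℂ`, i.e. `c` is in the image of `Hᵏ(Y; ℤ) → Hᵏ(Y; ℂ)` (a `ℤ`-valued `ℂ`-cocycle
is the image of a `ℤ`-cocycle, the coboundary commuting with `ℤ ↪ ℂ`).
[cite: HatcherAT2002, §3.1] [cite: VoisinHodgeI2002, §7.1.1] -/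
def IsIntegralClass {Y : Type u} [TopologicalSpace Y] {k : ℕ} (c : Literature.AlgebraicTopology.SingularHomology.singularCohomology ℂ ℂ Y k) :
    Prop :=
  ∃ z : Literature.AlgebraicTopology.SingularHomology.singularCochainComplex.cocycles ℂ ℂ Y k, Literature.AlgebraicTopology.SingularHomology.singularCohomology.π ℂ ℂ Y k z = c ∧
    ∀ σ : Literature.AlgebraicTopology.SingularHomology.SingularSimplex Y k,
      (Literature.AlgebraicTopology.SingularHomology.singularCochainComplex.iCocycles ℂ ℂ Y k z) σ ∈ Set.range (Int.cast : ℤ → ℂ)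

/-- `0` is an integral class (the zero cocycle). [cite: HatcherAT2002, §3.1] -/
theorem IsIntegralClass.zero {Y : Type u} [TopologicalSpace Y] {k : ℕ} :
    IsIntegralClass (0 : Literature.AlgebraicTopology.SingularHomology.singularCohomology ℂ ℂ Y k) :=
  ⟨0, map_zero _, fun σ ↦ ⟨0, by
    have h : Literature.AlgebraicTopology.SingularHomology.singularCochainComplex.iCocycles ℂ ℂ Y k (0 : Literature.AlgebraicTopology.SingularHomology.singularCochainComplex.cocycles ℂ ℂ Y k)
      = 0 := map_zero _
    rw [h, Int.cast_zero]; rfl⟩⟩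

/-- Integral classes are closed under addition. [cite: HatcherAT2002, §3.1] -/
theorem IsIntegralClass.add {Y : Type u} [TopologicalSpace Y] {k : ℕ}
    {c c' : Literature.AlgebraicTopology.SingularHomology.singularCohomology ℂ ℂ Y k} (hc : IsIntegralClass c) (hc' : IsIntegralClass c') :
    IsIntegralClass (c + c') := by
  obtain ⟨z, rfl, hz⟩ := hc
  obtain ⟨z', rfl, hz'⟩ := hc'
  refine ⟨z + z', map_add _ _ _, fun σ ↦ ?_⟩
  obtain ⟨a, ha⟩ := hz σ
  obtain ⟨a', ha'⟩ := hz' σ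
  exact ⟨a + a', by rw [map_add, Int.cast_add, ha, ha']; rfl⟩

/-- Integral classes are closed under multiplication by integers. [cite: HatcherAT2002, §3.1] -/
theorem IsIntegralClass.zsmul {Y : Type u} [TopologicalSpace Y] {k : ℕ}
    {c : Literature.AlgebraicTopology.SingularHomology.singularCohomology ℂ ℂ Y k} (hc : IsIntegralClass c) (a : ℤ) :
    IsIntegralClass ((a : ℂ) • c) := by
  obtain ⟨z, rfl, hz⟩ := hc
  refine ⟨(a : ℂ) • z, map_smul _ _ _, fun σ ↦ ?_⟩
  obtain ⟨b, hb⟩ := hz σ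
  exact ⟨a * b, by rw [Int.cast_mul, map_smul, hb]; rfl⟩

/-- Integral classes are rational classes (`ℤ ⊆ ℚ ⊆ ℂ`). [cite: HatcherAT2002, §3.1] -/
theorem IsIntegralClass.isRationalClass {Y : Type u} [TopologicalSpace Y] {k : ℕ}
    {c : Literature.AlgebraicTopology.SingularHomology.singularCohomology ℂ ℂ Y k} (hc : IsIntegralClass c) : IsRationalClass c := by
  obtain ⟨z, rfl, hz⟩ := hc
  refine ⟨z, rfl, fun σ ↦ ?_⟩
  obtain ⟨m, hm⟩ := hz σ
  exact ⟨m, by rw [← hm]; simp⟩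

/-! ### The Hodge filtration of a Hodge model -/

variable {n : ℕ} {X : Motives.SchemeOver ℂ}

/-- The **Hodge filtration** `Fʳ Hᵏ(X^an; ℂ) = ⨁_{p ≥ r, p + q = k} H^{p,q}` of a Hodge model, as a
subspace of `Hᵏ(X^an; ℂ)` (Voisin I, §7.1.1: `Fʳ Hᵏ = ⨁_{p ≥ r} H^{p,k-p}`).
[cite: VoisinHodgeI2002, §7.1.1] -/
def HodgeModel.hodgeFiltration (A : HodgeModel n X) (k r : ℕ) :
    Submodule ℂ (Literature.AlgebraicTopology.SingularHomology.singularCohomology ℂ ℂ A.carrier k) :=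
  ⨆ (p : ℕ) (q : ℕ) (_ : p + q = k) (_ : r ≤ p), A.hodgePQ k p q

/-- `H^{p,q} ⊆ Fʳ Hᵏ` for `p ≥ r`, `p + q = k`. [cite: VoisinHodgeI2002, §7.1.1] -/
theorem HodgeModel.hodgePQ_le_hodgeFiltration (A : HodgeModel n X) {k p q r : ℕ}
    (hpq : p + q = k) (hr : r ≤ p) : A.hodgePQ k p q ≤ A.hodgeFiltration k r :=
  le_iSup_of_le p (le_iSup_of_le q (le_iSup_of_le hpq (le_iSup_of_le hr le_rfl)))

/-- The Hodge filtration is decreasing: `Fˢ ⊆ Fʳ` for `r ≤ s`. [cite: VoisinHodgeI2002, §7.1.1] -/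
theorem HodgeModel.hodgeFiltration_mono (A : HodgeModel n X) (k : ℕ) {r s : ℕ} (h : r ≤ s) :
    A.hodgeFiltration k s ≤ A.hodgeFiltration k r :=
  iSup_le fun _ ↦ iSup_le fun _ ↦ iSup_le fun hpq ↦ iSup_le fun hs ↦
    A.hodgePQ_le_hodgeFiltration hpq (h.trans hs)

/-- `F⁰ Hᵏ ⊇ ⨆_{p+q=k} H^{p,q}`, which is everything by the Hodge decomposition of the model:
`F⁰ Hᵏ(X^an; ℂ) = ⊤` on the image of de Rham cohomology. Stated as the inclusion of every
`H^{p,q}`, `p + q = k`. [cite: VoisinHodgeI2002, §7.1.1] -/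
theorem HodgeModel.hodgePQ_le_hodgeFiltration_zero (A : HodgeModel n X) {k p q : ℕ}
    (hpq : p + q = k) : A.hodgePQ k p q ≤ A.hodgeFiltration k 0 :=
  A.hodgePQ_le_hodgeFiltration hpq (Nat.zero_le p)

variable (n X) in
/-- A class `c ∈ Hᵏ(X(ℂ); ℂ)` **lies in `Fʳ Hᵏ`** if for some Hodge model of `X` (all give the same
answer, module docstring of `RationalHodgeClasses`) its pull-back to `Hᵏ(X^an; ℂ)` lies in
`Fʳ = ⨁_{p ≥ r} H^{p,k-p}` (Deligne: Hodge classes are `H²ᵖ(X, ℚ) ∩ Fᵖ`). [cite: Deligne2000, §1]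
[cite: VoisinHodgeI2002, §7.1.1] -/
def IsInHodgeFiltration (k r : ℕ) (c : Literature.AlgebraicTopology.SingularHomology.singularCohomology ℂ ℂ (Motives.ComplexPoints X) k) : Prop :=
  ∃ A : HodgeModel n X, A.pullback k c ∈ A.hodgeFiltration k r

/-- A class of Hodge type `(p, q)` with `p ≥ r` lies in `Fʳ`. [cite: VoisinHodgeI2002, §7.1.1] -/
theorem IsInHodgeFiltration.of_isOfHodgeType {k p q r : ℕ} (hpq : p + q = k) (hr : r ≤ p)
    {c : Literature.AlgebraicTopology.SingularHomology.singularCohomology ℂ ℂ (Motives.ComplexPoints X) k} (hc : IsOfHodgeType n X k p q c) :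
    IsInHodgeFiltration n X k r c := by
  obtain ⟨A, hA⟩ := hc
  exact ⟨A, A.hodgePQ_le_hodgeFiltration hpq hr hA⟩

/-- In particular a Hodge class (type `(p, p)`) in `H²ᵖ` lies in `Fᵖ` (Deligne's
`H²ᵖ(X, ℚ) ∩ H^{p,p} = H²ᵖ(X, ℚ) ∩ Fᵖ`, the inclusion `⊆`). [cite: Deligne2000, §1] -/
theorem IsInHodgeFiltration.of_isOfHodgeType_pp {p : ℕ}
    {c : Literature.AlgebraicTopology.SingularHomology.singularCohomology ℂ ℂ (Motives.ComplexPoints X) (2 * p)} (hc : IsOfHodgeType n X (2 * p) p p c) :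
    IsInHodgeFiltration n X (2 * p) p c :=
  IsInHodgeFiltration.of_isOfHodgeType (by omega) le_rfl hc

/-- `0 ∈ Fʳ` as soon as a Hodge model exists. [cite: VoisinHodgeI2002, §7.1.1] -/
theorem IsInHodgeFiltration.zero (A : HodgeModel n X) (k r : ℕ) :
    IsInHodgeFiltration n X k r 0 :=
  ⟨A, by rw [map_zero]; exact Submodule.zero_mem _⟩

/-! ### Appended (v2): non-vacuity of `IsIntegralClass` and `F⁰ = ⊤` (review p6308 suggestions) -/

/-- The unit class `1 ∈ H⁰(Y; ℂ)` is integral (represented by the constant cocycle `1`), so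
`IsIntegralClass` is inhabited by a non-zero class whenever `H⁰(Y; ℂ) ≠ 0`. [cite: HatcherAT2002, §3.2 p. 211] -/
theorem IsIntegralClass.one {Y : Type u} [TopologicalSpace Y] :
    IsIntegralClass (Literature.AlgebraicTopology.SingularHomology.singularCohomology.one ℂ Y) :=
  ⟨_, rfl, fun σ ↦ ⟨1, by rw [Literature.AlgebraicTopology.SingularHomology.singularCochainComplex.iCocycles_mk]; simp⟩⟩

/-- `F⁰ Hᵏ(X^an; ℂ) = Hᵏ(X^an; ℂ)`: the pieces `H^{p,q}`, `p + q = k`, of a Hodge model span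
(Hodge decomposition, field `isInternal_hodgePQ`, transported along the de Rham comparison).
[cite: VoisinHodgeI2002, Thm. 6.18 and §7.1.1] -/
theorem HodgeModel.hodgeFiltration_zero (A : HodgeModel n X) (k : ℕ) : A.hodgeFiltration k 0 = ⊤ := by
  refine eq_top_iff.2 fun x _ ↦ ?_
  have h := (A.isInternal_hodgePQ k).submodule_iSup_eq_top
  obtain ⟨y, rfl⟩ := (A.deRham A.carrier k).surjective x
  have hy : y ∈ ⨆ pq : ↥(Finset.antidiagonal k), Literature.NumberTheory.Transcendental.hodgePQ A.model A.carrier k pq.1.1 pq.1.2 :=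
    h ▸ Submodule.mem_top
  have hmap : (⨆ pq : ↥(Finset.antidiagonal k), Literature.NumberTheory.Transcendental.hodgePQ A.model A.carrier k pq.1.1 pq.1.2).map
      (A.deRham A.carrier k).toLinearMap ≤ A.hodgeFiltration k 0 := by
    rw [Submodule.map_iSup]
    exact iSup_le fun pq ↦ A.hodgePQ_le_hodgeFiltration (k := k) (p := pq.1.1) (q := pq.1.2)
      (Finset.mem_antidiagonal.1 pq.2) (Nat.zero_le _)
  exact hmap (Submodule.mem_map_of_mem hy)

/-- Hence every class lies in `F⁰` as soon as a Hodge model exists. [cite: VoisinHodgeI2002, §7.1.1] -/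
theorem isInHodgeFiltration_zero_iff (k : ℕ) (c : Literature.AlgebraicTopology.SingularHomology.singularCohomology ℂ ℂ (Motives.ComplexPoints X) k) :
    IsInHodgeFiltration n X k 0 c ↔ Nonempty (HodgeModel n X) :=
  ⟨fun ⟨A, _⟩ ↦ ⟨A⟩, fun ⟨A⟩ ↦ ⟨A, by rw [A.hodgeFiltration_zero]; exact Submodule.mem_top⟩⟩

end HodgeTheory

end Literature.AlgebraicGeometry.HodgeTheory

end
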